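import Summits.CriticalPhenomena.PercolationContinuityZ3.Theorems.Transplant.FKConnectivityAllQPat3Defs
import Summits.CriticalPhenomena.PercolationContinuityZ3.Theorems.Transplant.FKConnectivityAllQAntipodalGluing
import HarnessLib

/-!
# Connectivity correlation inequalities for `φ_{w,q}`, every `q > 0` — THREE-MARK PATTERNS ACROSS A GLUING: the pattern of a
# glued configuration is the join table applied to the patterns of the parts

Theorems file (`--supports stmt-CriticalPhenomena-4575`), census lane `prim-bschramm-census` (gen 36) of the post-continuity programme (LANE 2 bschramm, FK sub-lane);
builds on p205010 (kernel theorem, internal audit signed; external expert review pending).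
No definitions, no named facts, no sorries; standard axioms.  Stage S1 (i) of census g35's kernel blueprint: the 3-point
analogues of fk-2's `FK.reachable_union_parallel` / `FK.reachable_union_series` (`…AntipodalGluing.lean`), all from the
vertex-separator walk splitting `GZGluing.walk_split`.
* `FK.reachable_union_off_left/right` — across an interface inside `{m}`, two points off one part are joined in the union iff
  inside the other part; `FK.reachable_union_mid_left/right` — a point off one part is joined to `m` iff inside its own part;
  `FK.reachable_union_par_third` — across an interface inside `{x, y}` with `s` off the first part, `x ↔ s` in the union iff
  `x ↔ s` in the second part, or `x ↔ y` (either part) and `y ↔ s` in the second part.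
* `FK.pat3_union_par` / `pat3_union_serL` / `pat3_union_serR` / `pat3_union_serS` — the pattern of `γ₁ ∪ γ₂` on `(x, y, s)` is
  `joinPar (conn γ₁ x y) (pat3 γ₂ x y s)` (parallel, `s` in the second part), `joinSerL (conn γ₁ x w) (pat3 γ₂ w y s)` (series,
  `s` in the second part), `joinSerR (conn γ₂ w y) (pat3 γ₁ x w s)` (series, `s` in the first part), `joinSerS (conn γ₁ x s)
  (conn γ₂ s y)` (series at the mark) — the JOIN tables of census g35's `fibres_ordered.json`, now theorems;
  `FK.ite_and_eq_corrPar` — the parallel level correction of `FK.apExp_parallel` is `corrPar`.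
[cite: Grimmett2006, §3.8 (pp. 61–62)] [cite: AyyerLinussonRavichandran2025, §7 (p. 22)]
-/

namespace Summit.CriticalPhenomena.PercolationContinuityZ3.Theorems

namespace FK

open SimpleGraph Literature.Probability.LatticeModels Literature.Probability.Percolation
open scoped Classical

variable {V : Type*}

/-! ### Connections of three marked points across a gluing -/

section Reach

variable {E₁ E₂ : Finset (Sym2 V)} {V₁ V₂ : Set V}

/-- Across a gluing whose interface lies inside `{m}`: two points OFF the first part are joined in `γ₁ ∪ γ₂` iff they are
joined inside `γ₂`. [folklore] -/
theorem reachable_union_off_left (h₁ : ∀ e ∈ (↑E₁ : Set (Sym2 V)), ∀ z ∈ e, z ∈ V₁)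
    (h₂ : ∀ e ∈ (↑E₂ : Set (Sym2 V)), ∀ z ∈ e, z ∈ V₂) {m : V} (hS : V₁ ∩ V₂ ⊆ {m}) {u v : V} (hu : u ∉ V₁) (hv : v ∉ V₁)
    {γ₁ γ₂ : Finset (Sym2 V)} (hγ₁ : γ₁ ⊆ E₁) (hγ₂ : γ₂ ⊆ E₂) :
    (openGraph (↑(γ₁ ∪ γ₂) : BondConfig V)).Reachable u v ↔ (openGraph (↑γ₂ : BondConfig V)).Reachable u v := by
  rw [Finset.coe_union]
  have hω₁ : (↑γ₁ : Set (Sym2 V)) ⊆ ↑E₁ := Finset.coe_subset.2 hγ₁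
  have hω₂ : (↑γ₂ : Set (Sym2 V)) ⊆ ↑E₂ := Finset.coe_subset.2 hγ₂
  refine ⟨fun h => ?_, fun h => GZGluing.reachable_union_of_side (Or.inr h)⟩
  obtain ⟨p⟩ := h
  have hS' : V₁ ∩ V₂ ⊆ ({m, v} : Set V) := fun z hz => Or.inl (hS hz)
  obtain ⟨s', hs'S, hside, hchain⟩ := GZGluing.walk_split h₁ h₂ hS' hω₁ hω₂ p (by simp)
  have h0 : (openGraph (↑γ₂ : BondConfig V)).Reachable u s' := by
    rcases hside with h | h
    · by_cases hus : u = s'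
      · subst hus; exact Reachable.refl _
      · exact absurd (GZGluing.mem_of_reachable_ne h₁ hω₁ h hus) hu
    · exact h
  have hA : ∀ a b, a ∈ ({z | (openGraph (↑γ₂ : BondConfig V)).Reachable u z} : Set V) →
      (a ∈ ({m, v} : Set V) ∧ b ∈ ({m, v} : Set V) ∧
        ((openGraph (↑γ₁ : BondConfig V)).Reachable a b ∨ (openGraph (↑γ₂ : BondConfig V)).Reachable a b)) →
      b ∈ ({z | (openGraph (↑γ₂ : BondConfig V)).Reachable u z} : Set V) := by
    rintro a b ha ⟨haS, hbS, hab | hab⟩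
    · by_cases heq : a = b
      · subst heq; exact ha
      · have hb1 : b ∈ V₁ := GZGluing.mem_of_reachable_ne h₁ hω₁ hab.symm (Ne.symm heq)
        have ha1 : a ∈ V₁ := GZGluing.mem_of_reachable_ne h₁ hω₁ hab heq
        rcases hbS with rfl | rfl
        · rcases haS with rfl | rfl
          · exact absurd rfl heq
          · exact absurd ha1 hv
        · exact absurd hb1 hv
    · exact Reachable.trans ha hab
  exact GZGluing.reflTransGen_mem hA hchain h0

/-- Across a gluing whose interface lies inside `{m}`: two points OFF the second part are joined in `γ₁ ∪ γ₂` iff they are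
joined inside `γ₁`. [folklore] -/
theorem reachable_union_off_right (h₁ : ∀ e ∈ (↑E₁ : Set (Sym2 V)), ∀ z ∈ e, z ∈ V₁)
    (h₂ : ∀ e ∈ (↑E₂ : Set (Sym2 V)), ∀ z ∈ e, z ∈ V₂) {m : V} (hS : V₁ ∩ V₂ ⊆ {m}) {u v : V} (hu : u ∉ V₂) (hv : v ∉ V₂)
    {γ₁ γ₂ : Finset (Sym2 V)} (hγ₁ : γ₁ ⊆ E₁) (hγ₂ : γ₂ ⊆ E₂) :
    (openGraph (↑(γ₁ ∪ γ₂) : BondConfig V)).Reachable u v ↔ (openGraph (↑γ₁ : BondConfig V)).Reachable u v := by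
  have hS' : V₂ ∩ V₁ ⊆ ({m} : Set V) := fun z hz => hS ⟨hz.2, hz.1⟩
  rw [Finset.union_comm]
  exact reachable_union_off_left h₂ h₁ hS' hu hv hγ₂ hγ₁

/-- Across a gluing whose interface lies inside `{m}`: a point OFF the second part is joined to `m` in `γ₁ ∪ γ₂` iff it is
joined to `m` inside `γ₁`. [folklore] -/
theorem reachable_union_mid_left (h₁ : ∀ e ∈ (↑E₁ : Set (Sym2 V)), ∀ z ∈ e, z ∈ V₁)
    (h₂ : ∀ e ∈ (↑E₂ : Set (Sym2 V)), ∀ z ∈ e, z ∈ V₂) {m : V} (hS : V₁ ∩ V₂ ⊆ {m}) {u : V} (hu : u ∉ V₂)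
    {γ₁ γ₂ : Finset (Sym2 V)} (hγ₁ : γ₁ ⊆ E₁) (hγ₂ : γ₂ ⊆ E₂) :
    (openGraph (↑(γ₁ ∪ γ₂) : BondConfig V)).Reachable u m ↔ (openGraph (↑γ₁ : BondConfig V)).Reachable u m := by
  rw [Finset.coe_union]
  have hω₁ : (↑γ₁ : Set (Sym2 V)) ⊆ ↑E₁ := Finset.coe_subset.2 hγ₁
  have hω₂ : (↑γ₂ : Set (Sym2 V)) ⊆ ↑E₂ := Finset.coe_subset.2 hγ₂
  refine ⟨fun h => ?_, fun h => GZGluing.reachable_union_of_side (Or.inl h)⟩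
  obtain ⟨p⟩ := h
  obtain ⟨s', hs'S, hside, -⟩ := GZGluing.walk_split h₁ h₂ hS hω₁ hω₂ p (by simp)
  have hs'm : s' = m := hs'S
  subst hs'm
  rcases hside with h | h
  · exact h
  · by_cases hus : u = s'
    · subst hus; exact Reachable.refl _
    · exact absurd (GZGluing.mem_of_reachable_ne h₂ hω₂ h hus) hu

/-- Across a gluing whose interface lies inside `{m}`: a point OFF the first part is joined to `m` in `γ₁ ∪ γ₂` iff it is
joined to `m` inside `γ₂`. [folklore] -/
theorem reachable_union_mid_right (h₁ : ∀ e ∈ (↑E₁ : Set (Sym2 V)), ∀ z ∈ e, z ∈ V₁)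
    (h₂ : ∀ e ∈ (↑E₂ : Set (Sym2 V)), ∀ z ∈ e, z ∈ V₂) {m : V} (hS : V₁ ∩ V₂ ⊆ {m}) {u : V} (hu : u ∉ V₁)
    {γ₁ γ₂ : Finset (Sym2 V)} (hγ₁ : γ₁ ⊆ E₁) (hγ₂ : γ₂ ⊆ E₂) :
    (openGraph (↑(γ₁ ∪ γ₂) : BondConfig V)).Reachable u m ↔ (openGraph (↑γ₂ : BondConfig V)).Reachable u m := by
  have hS' : V₂ ∩ V₁ ⊆ ({m} : Set V) := fun z hz => hS ⟨hz.2, hz.1⟩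
  rw [Finset.union_comm]
  exact reachable_union_mid_left h₂ h₁ hS' hu hγ₂ hγ₁

/-- PARALLEL gluing (interface inside `{x, y}`), third point `s` off the first part: `x ↔ s` in `γ₁ ∪ γ₂` iff
`x ↔ s` inside `γ₂`, or `x ↔ y` (on either side) and `y ↔ s` inside `γ₂`. [folklore] -/
theorem reachable_union_par_third (h₁ : ∀ e ∈ (↑E₁ : Set (Sym2 V)), ∀ z ∈ e, z ∈ V₁)
    (h₂ : ∀ e ∈ (↑E₂ : Set (Sym2 V)), ∀ z ∈ e, z ∈ V₂) {x y s : V} (hS : V₁ ∩ V₂ ⊆ {x, y}) (hsV : s ∉ V₁)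
    (hsx : s ≠ x) (hsy : s ≠ y) {γ₁ γ₂ : Finset (Sym2 V)} (hγ₁ : γ₁ ⊆ E₁) (hγ₂ : γ₂ ⊆ E₂) :
    (openGraph (↑(γ₁ ∪ γ₂) : BondConfig V)).Reachable x s ↔
      (openGraph (↑γ₂ : BondConfig V)).Reachable x s ∨
        (((openGraph (↑γ₁ : BondConfig V)).Reachable x y ∨ (openGraph (↑γ₂ : BondConfig V)).Reachable x y) ∧
          (openGraph (↑γ₂ : BondConfig V)).Reachable y s) := by
  have hω₁ : (↑γ₁ : Set (Sym2 V)) ⊆ ↑E₁ := Finset.coe_subset.2 hγ₁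
  have hω₂ : (↑γ₂ : Set (Sym2 V)) ⊆ ↑E₂ := Finset.coe_subset.2 hγ₂
  rw [Finset.coe_union]
  constructor
  · rintro ⟨p⟩
    have hS' : V₁ ∩ V₂ ⊆ ({x, y, s} : Set V) := by
      intro z hz
      rcases hS hz with h | h
      · exact Or.inl h
      · exact Or.inr (Or.inl h)
    obtain ⟨s', hs'S, hside, hchain⟩ := GZGluing.walk_split h₁ h₂ hS' hω₁ hω₂ p (by simp)
    -- prepend the first segment as a hop: the chain starts at `x ∈ S`
    have hchain' : Relation.ReflTransGen
        (fun u v => u ∈ ({x, y, s} : Set V) ∧ v ∈ ({x, y, s} : Set V) ∧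
          ((openGraph (↑γ₁ : BondConfig V)).Reachable u v ∨ (openGraph (↑γ₂ : BondConfig V)).Reachable u v)) x s :=
      Relation.ReflTransGen.head ⟨by simp, hs'S, hside⟩ hchain
    -- invariant
    set XY : Prop := (openGraph (↑γ₁ : BondConfig V)).Reachable x y ∨ (openGraph (↑γ₂ : BondConfig V)).Reachable x y
    set XS : Prop := (openGraph (↑γ₂ : BondConfig V)).Reachable x s ∨
      (XY ∧ (openGraph (↑γ₂ : BondConfig V)).Reachable y s)
    have key : ∀ u v, u ∈ ({z | z = x ∨ (z = y ∧ XY) ∨ (z = s ∧ XS)} : Set V) →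
        (u ∈ ({x, y, s} : Set V) ∧ v ∈ ({x, y, s} : Set V) ∧
          ((openGraph (↑γ₁ : BondConfig V)).Reachable u v ∨ (openGraph (↑γ₂ : BondConfig V)).Reachable u v)) →
        v ∈ ({z | z = x ∨ (z = y ∧ XY) ∨ (z = s ∧ XS)} : Set V) := by
      rintro u v hu ⟨-, hv, huv⟩
      -- a hop ending at `s` (or starting at `s`) with distinct ends lies in `γ₂`
      have side_s : ∀ {a : V}, a ≠ s →
          ((openGraph (↑γ₁ : BondConfig V)).Reachable a s ∨ (openGraph (↑γ₂ : BondConfig V)).Reachable a s) →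
          (openGraph (↑γ₂ : BondConfig V)).Reachable a s := by
        intro a has h
        rcases h with h | h
        · exact absurd (GZGluing.mem_of_reachable_ne h₁ hω₁ h.symm (Ne.symm has)) hsV
        · exact h
      have side_s' : ∀ {a : V}, a ≠ s →
          ((openGraph (↑γ₁ : BondConfig V)).Reachable s a ∨ (openGraph (↑γ₂ : BondConfig V)).Reachable s a) →
          (openGraph (↑γ₂ : BondConfig V)).Reachable s a := by
        intro a has h
        rcases h with h | h
        · exact absurd (GZGluing.mem_of_reachable_ne h₁ hω₁ h (Ne.symm has)) hsV
        · exact h.symm.symm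
      rcases hv with rfl | rfl | rfl
      · exact Or.inl rfl
      · -- v = y
        refine Or.inr (Or.inl ⟨rfl, ?_⟩)
        rcases hu with rfl | ⟨rfl, hXY⟩ | ⟨rfl, hXS⟩
        · exact huv
        · exact hXY
        · -- hop s → y inside γ₂
          have hsy' := side_s' (Ne.symm hsy) huv
          rcases hXS with h | ⟨hXY, _⟩
          · exact Or.inr (h.trans hsy')
          · exact hXY
      · -- v = s
        refine Or.inr (Or.inr ⟨rfl, ?_⟩)
        rcases hu with rfl | ⟨rfl, hXY⟩ | ⟨rfl, hXS⟩
        · exact Or.inl (side_s (Ne.symm hsx) huv)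
        · exact Or.inr ⟨hXY, side_s (Ne.symm hsy) huv⟩
        · exact hXS
    have hx0 : x ∈ ({z | z = x ∨ (z = y ∧ XY) ∨ (z = s ∧ XS)} : Set V) := Or.inl rfl
    rcases GZGluing.reflTransGen_mem key hchain' hx0 with h | ⟨h, _⟩ | ⟨_, h⟩
    · exact absurd h hsx
    · exact absurd h hsy
    · exact h
  · rintro (h | ⟨hxy, hys⟩)
    · exact GZGluing.reachable_union_of_side (Or.inr h)
    · have hxy' : (openGraph ((↑γ₁ : Set (Sym2 V)) ∪ ↑γ₂)).Reachable x y := GZGluing.reachable_union_of_side hxy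
      exact hxy'.trans (GZGluing.reachable_union_of_side (Or.inr hys))

end Reach

/-! ### Patterns of a glued configuration -/

section PatGlue

variable {E₁ E₂ : Finset (Sym2 V)} {V₁ V₂ : Set V}

/-- **PARALLEL gluing of patterns**: for two `(x, y)`-parts meeting inside `{x, y}` and the third mark `s` off the first part,
the pattern of `γ₁ ∪ γ₂` on `(x, y, s)` is the parallel join of `1{x ↔ y in γ₁}` with the pattern of `γ₂`. [folklore] -/
theorem pat3_union_par (h₁ : ∀ e ∈ (↑E₁ : Set (Sym2 V)), ∀ z ∈ e, z ∈ V₁)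
    (h₂ : ∀ e ∈ (↑E₂ : Set (Sym2 V)), ∀ z ∈ e, z ∈ V₂) {x y s : V} (hS : V₁ ∩ V₂ ⊆ {x, y}) (hsV : s ∉ V₁)
    (hsx : s ≠ x) (hsy : s ≠ y) {γ₁ γ₂ : Finset (Sym2 V)} (hγ₁ : γ₁ ⊆ E₁) (hγ₂ : γ₂ ⊆ E₂) :
    pat3 (γ₁ ∪ γ₂) x y s =
      joinPar (conn γ₁ x y) (pat3 γ₂ x y s) := by
  have exy := reachable_union_parallel h₁ h₂ hS hγ₁ hγ₂
  have exs := reachable_union_par_third h₁ h₂ hS hsV hsx hsy hγ₁ hγ₂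
  have hS' : V₁ ∩ V₂ ⊆ ({y, x} : Set V) := by rw [Set.pair_comm]; exact hS
  have eys := reachable_union_par_third h₁ h₂ hS' hsV hsy hsx hγ₁ hγ₂
  have sxy : (openGraph (↑γ₁ : BondConfig V)).Reachable y x ∨ (openGraph (↑γ₂ : BondConfig V)).Reachable y x ↔
      (openGraph (↑γ₁ : BondConfig V)).Reachable x y ∨ (openGraph (↑γ₂ : BondConfig V)).Reachable x y :=
    ⟨fun h => h.imp Reachable.symm Reachable.symm, fun h => h.imp Reachable.symm Reachable.symm⟩
  apply pat3_eq_of_iff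
  · rw [joinPar_xy, Bool.or_eq_true, conn_iff, pat3_xy_iff]
    exact exy
  · rw [joinPar_xs, Bool.or_eq_true, Bool.and_eq_true, conn_iff, pat3_xs_iff, pat3_ys_iff, exs]
    constructor
    · rintro (h | ⟨h1 | h1, h2⟩)
      · exact Or.inl h
      · exact Or.inr ⟨h1, h2⟩
      · exact Or.inl (h1.trans h2)
    · rintro (h | ⟨h1, h2⟩)
      · exact Or.inl h
      · exact Or.inr ⟨Or.inl h1, h2⟩
  · rw [joinPar_ys, Bool.or_eq_true, Bool.and_eq_true, conn_iff, pat3_ys_iff, pat3_xs_iff, eys, sxy]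
    constructor
    · rintro (h | ⟨h1 | h1, h2⟩)
      · exact Or.inl h
      · exact Or.inr ⟨h1, h2⟩
      · exact Or.inl (h1.symm.trans h2)
    · rintro (h | ⟨h1, h2⟩)
      · exact Or.inl h
      · exact Or.inr ⟨Or.inl h1, h2⟩

/-- **SERIES gluing of patterns, mark in the second part**: `(x,w)`-part `E₁` and `(w,y)`-part `E₂` with `s` inner in `E₂`,
meeting inside `{w}`: the pattern of `γ₁ ∪ γ₂` on `(x, y, s)` is the series join of `1{x ↔ w in γ₁}` with the pattern of
`γ₂` on `(w, y, s)`. [folklore] -/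
theorem pat3_union_serL (h₁ : ∀ e ∈ (↑E₁ : Set (Sym2 V)), ∀ z ∈ e, z ∈ V₁)
    (h₂ : ∀ e ∈ (↑E₂ : Set (Sym2 V)), ∀ z ∈ e, z ∈ V₂) {x w y s : V} (hS : V₁ ∩ V₂ ⊆ {w}) (hxV : x ∉ V₂)
    (hyV : y ∉ V₁) (hsV : s ∉ V₁) (hxw : x ≠ w) (hyw : y ≠ w) (hxy : x ≠ y) (hsw : s ≠ w) (hxs : x ≠ s)
    {γ₁ γ₂ : Finset (Sym2 V)} (hγ₁ : γ₁ ⊆ E₁) (hγ₂ : γ₂ ⊆ E₂) :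
    pat3 (γ₁ ∪ γ₂) x y s =
      joinSerL (conn γ₁ x w) (pat3 γ₂ w y s) := by
  have exy := reachable_union_series h₁ h₂ hS hxV hyV hxw hyw hxy hγ₁ hγ₂
  have exs := reachable_union_series h₁ h₂ hS hxV hsV hxw hsw hxs hγ₁ hγ₂
  have eys := reachable_union_off_left h₁ h₂ hS hyV hsV hγ₁ hγ₂ (u := y) (v := s)
  apply pat3_eq_of_iff
  · rw [joinSerL_xy, Bool.and_eq_true, conn_iff, pat3_xy_iff]
    exact exy
  · rw [joinSerL_xs, Bool.and_eq_true, conn_iff, pat3_xs_iff]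
    exact exs
  · rw [joinSerL_ys, pat3_ys_iff]
    exact eys

/-- **SERIES gluing of patterns, mark in the first part**: `(x,w)`-part `E₁` with `s` inner and `(w,y)`-part `E₂`, meeting
inside `{w}`: the pattern of `γ₁ ∪ γ₂` on `(x, y, s)` is the series join of the pattern of `γ₁` on `(x, w, s)` with
`1{w ↔ y in γ₂}`. [folklore] -/
theorem pat3_union_serR (h₁ : ∀ e ∈ (↑E₁ : Set (Sym2 V)), ∀ z ∈ e, z ∈ V₁)
    (h₂ : ∀ e ∈ (↑E₂ : Set (Sym2 V)), ∀ z ∈ e, z ∈ V₂) {x w y s : V} (hS : V₁ ∩ V₂ ⊆ {w}) (hxV : x ∉ V₂)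
    (hsV : s ∉ V₂) (hyV : y ∉ V₁) (hxw : x ≠ w) (hyw : y ≠ w) (hxy : x ≠ y) (hsw : s ≠ w) (hsy : s ≠ y)
    {γ₁ γ₂ : Finset (Sym2 V)} (hγ₁ : γ₁ ⊆ E₁) (hγ₂ : γ₂ ⊆ E₂) :
    pat3 (γ₁ ∪ γ₂) x y s =
      joinSerR (conn γ₂ w y) (pat3 γ₁ x w s) := by
  have exy := reachable_union_series h₁ h₂ hS hxV hyV hxw hyw hxy hγ₁ hγ₂
  have exs := reachable_union_off_right h₁ h₂ hS hxV hsV hγ₁ hγ₂ (u := x) (v := s)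
  have esy := reachable_union_series h₁ h₂ hS hsV hyV hsw hyw hsy hγ₁ hγ₂
  apply pat3_eq_of_iff
  · rw [joinSerR_xy, Bool.and_eq_true, conn_iff, pat3_xy_iff]
    exact exy
  · rw [joinSerR_xs, pat3_xs_iff]
    exact exs
  · rw [joinSerR_ys, Bool.and_eq_true, conn_iff, pat3_ys_iff]
    constructor
    · intro h
      obtain ⟨h1, h2⟩ := esy.1 h.symm
      exact ⟨h2, h1.symm⟩
    · rintro ⟨h1, h2⟩
      exact (esy.2 ⟨h2.symm, h1⟩).symm

/-- **SERIES gluing of patterns at the mark**: `(x,s)`-part `E₁` and `(s,y)`-part `E₂` meeting inside `{s}`: the pattern of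
`γ₁ ∪ γ₂` on `(x, y, s)` is determined by `1{x ↔ s in γ₁}` and `1{s ↔ y in γ₂}`. [folklore] -/
theorem pat3_union_serS (h₁ : ∀ e ∈ (↑E₁ : Set (Sym2 V)), ∀ z ∈ e, z ∈ V₁)
    (h₂ : ∀ e ∈ (↑E₂ : Set (Sym2 V)), ∀ z ∈ e, z ∈ V₂) {x s y : V} (hS : V₁ ∩ V₂ ⊆ {s}) (hxV : x ∉ V₂)
    (hyV : y ∉ V₁) (hxs : x ≠ s) (hys : y ≠ s) (hxy : x ≠ y)
    {γ₁ γ₂ : Finset (Sym2 V)} (hγ₁ : γ₁ ⊆ E₁) (hγ₂ : γ₂ ⊆ E₂) :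
    pat3 (γ₁ ∪ γ₂) x y s =
      joinSerS (conn γ₁ x s) (conn γ₂ s y) := by
  have exy := reachable_union_series h₁ h₂ hS hxV hyV hxs hys hxy hγ₁ hγ₂
  have exs := reachable_union_mid_left h₁ h₂ hS hxV hγ₁ hγ₂ (u := x)
  have eys := reachable_union_mid_right h₁ h₂ hS hyV hγ₁ hγ₂ (u := y)
  apply pat3_eq_of_iff
  · rw [joinSerS_xy, Bool.and_eq_true, conn_iff, conn_iff]
    exact exy
  · rw [joinSerS_xs, conn_iff]
    exact exs
  · rw [joinSerS_ys, conn_iff, eys]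
    exact ⟨Reachable.symm, Reachable.symm⟩

/-- The parallel level correction read off the pattern: `1{x ↔ y in γ₁ and in γ₂} = corrPar (1{x ↔ y in γ₁}) (pat3 γ₂)`.
[folklore] -/
theorem ite_and_eq_corrPar (γ₁ γ₂ : Finset (Sym2 V)) (x y s : V)
    {d : Decidable ((openGraph (↑γ₁ : BondConfig V)).Reachable x y ∧ (openGraph (↑γ₂ : BondConfig V)).Reachable x y)} :
    @ite ℕ ((openGraph (↑γ₁ : BondConfig V)).Reachable x y ∧ (openGraph (↑γ₂ : BondConfig V)).Reachable x y) d 1 0 =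
      corrPar (conn γ₁ x y) (pat3 γ₂ x y s) := by
  have hb := pat3_xy_iff γ₂ x y s
  have ha := conn_iff γ₁ x y
  by_cases h1 : (openGraph (↑γ₁ : BondConfig V)).Reachable x y <;>
  by_cases h2 : (openGraph (↑γ₂ : BondConfig V)).Reachable x y <;>
  cases hP : pat3 γ₂ x y s <;>
  cases hc : conn γ₁ x y <;>
  simp_all [corrPar, Pat3.xy]

end PatGlue

end FK

end Summit.CriticalPhenomena.PercolationContinuityZ3.Theorems
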